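import Mathlib
import Literature.Computability.AlgebraicComplexity.TavenasHutchinsonFamily
import Literature.Computability.AlgebraicComplexity.TavenasVnWitness
import Summits.ValiantsHypothesis.ValiantsHypothesis.Theorems.LacunarySymmetroidThetaWitness
import Summits.ValiantsHypothesis.ValiantsHypothesis.Theorems.LacunarySymmetroidTowerDoorDefs

/-!
# Route LacunarySymmetroid — TOWER DOOR, witness part 1/2: sub-sums of Tavenas' Hutchinson family; the partial Kronecker substitution

Stage 1: the sub-sums `subV n I` keep Hutchinson's dominant-term sign pattern — at Tavenas' points `x_u` (`u ∈ I`) `sign subV(x_u) = (−1)^u`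
(`sign_eval_xPt_subV`), hence `≥ r − 1` distinct real roots along any admissible enumeration (`le_card_roots_subV`).  Stage 2: killing the
`x`-variables of Tavenas' bit polynomial `hV` outside a set `P` of bit positions evaluates it to `subV ν (goodIdx ν P)` (`eval_FP_hV`).
Verbatim from the workfile (namespace `…Theorems.LacunarySymmetroid.TowerDoor`; definitions in …TowerDoorDefs).
HONEST FRAMING: VP ≠ VNP is NOT proved by any of the tower-door files; `TowerB` (head of LINE (B) `Cruxes/WeakLifting/Lines/tower_graft.lean`) is
OPEN; no `closes` binder of any route is touched (director R300 (2)).  Landing hand: val-sym-eng-2 g7 (P1, director-valiant R300 (3), lead R2806/R2809;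
source `Cruxes/MatrixDescartes/TowerDoorComplete.lean` @ca015990e815 by val-idea-22 g7, crit-6 V#35 PASS).
[folklore] Hutchinson 1923; Tavenas 2014 Lemme 3.36 / Cor. 3.37 (tree theorems).
-/

set_option linter.dupNamespace false

open Finset Polynomial
open scoped BigOperators

namespace Summit.ValiantsHypothesis.ValiantsHypothesis.Theorems.LacunarySymmetroid.TowerDoor

open Literature.Computability.AlgebraicComplexity
open Literature.Computability.AlgebraicComplexity.TavenasVn
open Literature.Computability.AlgebraicComplexity.BoolGadgets (sum_boolVec_eq_sum_range ofBits_eq_sum)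
open Literature.Computability.Complexity.ArithCkt (ofBits_bitsOf)
open Summit.ValiantsHypothesis.ValiantsHypothesis.Theorems.SymmetroidDescartes (complexity_pow_le)



/-- Auxiliary step `map_subV` of the tower-door witness (verbatim from the workfile). [folklore] -/
theorem map_subV (n : ℕ) (I : Finset ℕ) : (subV n I).map (Int.castRingHom ℝ) =
    ∑ i ∈ range (2 ^ n), if i ∈ I then C ((2 : ℝ) ^ vExp n i) * X ^ i else 0 := by
  unfold subV
  rw [Polynomial.map_sum]
  refine Finset.sum_congr rfl fun i _ => ?_
  split_ifs
  · rw [Polynomial.map_mul, Polynomial.map_pow, map_X, map_C]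
    simp
  · simp

/-- coefficients of `subV`. -/
theorem coeff_subV (n : ℕ) (I : Finset ℕ) (k : ℕ) :
    (subV n I).coeff k = if k < 2 ^ n ∧ k ∈ I then (2 : ℤ) ^ vExp n k else 0 := by
  unfold subV
  rw [finsetSum_coeff]
  have hterm : ∀ i, (if i ∈ I then C ((2 : ℤ) ^ vExp n i) * X ^ i else 0 : ℤ[X]).coeff k =
      if k = i ∧ i ∈ I then (2 : ℤ) ^ vExp n i else 0 := by
    intro i
    by_cases hiI : i ∈ I
    · rw [if_pos hiI, Polynomial.coeff_C_mul_X_pow]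
      by_cases hki : k = i
      · simp [hki, hiI]
      · simp [hki]
    · simp [hiI]
  simp_rw [hterm]
  by_cases hk : k < 2 ^ n
  · rw [Finset.sum_eq_single k]
    · by_cases hkI : k ∈ I
      · simp [hk, hkI]
      · simp [hkI]
    · intro i _ hik
      rw [if_neg]
      rintro ⟨rfl, _⟩
      exact hik rfl
    · intro hk'
      exact absurd (mem_range.2 hk) hk'
  · rw [if_neg (fun h => hk h.1)]
    refine Finset.sum_eq_zero fun i hi => ?_
    rw [if_neg]
    rintro ⟨rfl, _⟩
    exact hk (mem_range.1 hi)


/-- **The `u`-th term dominates any sub-sum containing it**: `0 < (-1)^u Z_u^I` for `u < N`, `u ∈ I`. -/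
theorem zSumI_sign {N u : ℕ} {I : Finset ℕ} (hu : u < N) (huI : u ∈ I) : 0 < (-1) ^ u * zSumI N u I := by
  set E : ℕ := N * (N - 1) + u * u with hE
  have h1N : 1 ≤ N := by omega
  have huE : u ≤ E := (Nat.le_mul_self u).trans (Nat.le_add_left _ _)
  have hNE : N - (u + 1) ≤ E := by
    have : N - (u + 1) ≤ N * (N - 1) := by
      calc N - (u + 1) ≤ N - 1 := by omega
        _ ≤ N * (N - 1) := Nat.le_mul_of_pos_left _ h1N
    exact this.trans (Nat.le_add_right _ _)
  set g : ℕ → ℤ := fun i => if i ∈ I then (-1) ^ (u + i) * 4 ^ (E - sqd i u) else 0 with hg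
  have hsum : (-1) ^ u * zSumI N u I = ∑ i ∈ range N, g i := by
    rw [zSumI, mul_sum]
    refine sum_congr rfl fun i _ => ?_
    simp only [hg]
    split_ifs
    · simp only [pow_add]; ring
    · simp
  have hsplit : ∑ i ∈ range N, g i = ∑ i ∈ Ico 0 u, g i + (g u + ∑ i ∈ Ico (u + 1) N, g i) := by
    rw [range_eq_Ico, ← sum_Ico_consecutive g (Nat.zero_le u) hu.le, sum_eq_sum_Ico_succ_bot hu]
  have hgu : g u = 4 ^ E := by
    simp only [hg, if_pos huI, sqd_self, Nat.sub_zero, ← two_mul, pow_mul, neg_one_sq, one_pow, one_mul]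
  have hterm : ∀ i d, d ≤ sqd i u → -(4 : ℤ) ^ (E - d) ≤ g i := by
    intro i d hd
    have h4 : (4 : ℤ) ^ (E - sqd i u) ≤ 4 ^ (E - d) :=
      pow_le_pow_right₀ (by norm_num) (Nat.sub_le_sub_left hd E)
    have h4' : (0 : ℤ) ≤ 4 ^ (E - sqd i u) := by positivity
    have h4'' : (0 : ℤ) ≤ 4 ^ (E - d) := by positivity
    simp only [hg]
    split_ifs
    · rcases neg_one_pow_eq_or ℤ (u + i) with h | h <;> rw [h] <;> linarith
    · linarith
  have hT₁ : -(∑ i ∈ Ico 0 u, (4 : ℤ) ^ (E - (u - i))) ≤ ∑ i ∈ Ico 0 u, g i := by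
    rw [← sum_neg_distrib]
    exact sum_le_sum fun i _ => hterm i _ (sub_le_sqd i u)
  have hT₂ : -(∑ i ∈ Ico (u + 1) N, (4 : ℤ) ^ (E - (i - u))) ≤ ∑ i ∈ Ico (u + 1) N, g i := by
    rw [← sum_neg_distrib]
    exact sum_le_sum fun i _ => hterm i _ (sub_le_sqd' i u)
  have hG₁ : 3 * ∑ i ∈ Ico 0 u, (4 : ℤ) ^ (E - (u - i)) + 4 ^ (E - u) = 4 ^ E := by
    rw [← three_mul_geom4_add huE, ← range_eq_Ico, ← sum_range_reflect _ u]
    congr 2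
    refine sum_congr rfl fun i hi => ?_
    have := mem_range.1 hi
    congr 2; omega
  have hG₂ : 3 * ∑ i ∈ Ico (u + 1) N, (4 : ℤ) ^ (E - (i - u)) + 4 ^ (E - (N - (u + 1))) = 4 ^ E := by
    rw [← three_mul_geom4_add hNE, sum_Ico_eq_sum_range]
    congr 2
    refine sum_congr rfl fun i _ => ?_
    congr 2; omega
  have hp₀ : (0 : ℤ) < 4 ^ E := by positivity
  have hp₁ : (0 : ℤ) < 4 ^ (E - u) := by positivity
  have hp₂ : (0 : ℤ) < 4 ^ (E - (N - (u + 1))) := by positivity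
  rw [hsum, hsplit, hgu]
  linarith

/-- **The exact evaluation**: `4^{N(N-1)} subV(x_u) = Z_u^I` for `u < N = 2^n`. -/
theorem pow_mul_eval_xPt_subV (n u : ℕ) (I : Finset ℕ) (hu : u < 2 ^ n) :
    (4 : ℝ) ^ (2 ^ n * (2 ^ n - 1)) * ((subV n I).map (Int.castRingHom ℝ)).eval (xPt (2 ^ n) u) =
      (zSumI (2 ^ n) u I : ℝ) := by
  set N : ℕ := 2 ^ n with hN
  rw [map_subV, eval_finsetSum, mul_sum, zSumI, Int.cast_sum]
  refine sum_congr rfl fun i hi => ?_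
  have hi' : i < N := mem_range.1 hi
  split_ifs with hiI
  · rw [eval_mul, eval_C, eval_pow, eval_X]
    push_cast
    have h2 : (2 : ℝ) ^ vExp n i = 4 ^ (i * (N - 1 - i)) := by
      rw [vExp, ← hN, pow_mul]; norm_num
    have key : (4 : ℝ) ^ (N * (N - 1)) * 4 ^ (i * (N - 1 - i)) * 4 ^ ((2 * u + 1) * i) =
        4 ^ (N * (N - 1) + u * u - sqd i u) * 4 ^ (N * i) := by
      rw [← pow_add, ← pow_add, ← pow_add, expo_identity hi' hu]
    have h4c : (4 : ℝ) ^ (N * i) ≠ 0 := by positivity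
    rw [h2, xPt, div_pow, neg_pow, ← pow_mul, ← pow_mul]
    have hre : (4 : ℝ) ^ (N * (N - 1)) * (4 ^ (i * (N - 1 - i)) * ((-1) ^ i * 4 ^ ((2 * u + 1) * i) / 4 ^ (N * i)))
        = (-1) ^ i * (4 ^ (N * (N - 1)) * 4 ^ (i * (N - 1 - i)) * 4 ^ ((2 * u + 1) * i)) / 4 ^ (N * i) := by
      ring
    rw [hre, key, ← mul_assoc, mul_div_cancel_right₀ _ h4c]
  · simp

/-- **Sign of the sub-sum at `x_u`**: `0 < (-1)^u subV(x_u)` for `u < 2^n`, `u ∈ I`. -/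
theorem sign_eval_xPt_subV (n u : ℕ) (I : Finset ℕ) (hu : u < 2 ^ n) (huI : u ∈ I) :
    0 < (-1 : ℝ) ^ u * ((subV n I).map (Int.castRingHom ℝ)).eval (xPt (2 ^ n) u) := by
  have h := zSumI_sign hu huI
  have h' : (0 : ℝ) < (((-1) ^ u * zSumI (2 ^ n) u I : ℤ) : ℝ) := by exact_mod_cast h
  rw [Int.cast_mul, Int.cast_pow, Int.cast_neg, Int.cast_one, ← pow_mul_eval_xPt_subV n u I hu,
    mul_left_comm] at h'
  exact (mul_pos_iff_of_pos_left (by positivity)).1 h'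

/-- Auxiliary step `map_subV_ne_zero` of the tower-door witness (verbatim from the workfile). [folklore] -/
theorem map_subV_ne_zero (n : ℕ) (I : Finset ℕ) {u : ℕ} (hu : u < 2 ^ n) (huI : u ∈ I) :
    (subV n I).map (Int.castRingHom ℝ) ≠ 0 := by
  intro h
  have := sign_eval_xPt_subV n u I hu huI
  rw [h, eval_zero, mul_zero] at this
  exact lt_irrefl _ this

/-- `xPt N` is strictly decreasing. -/
theorem xPt_strictAnti (N : ℕ) : StrictAnti (xPt N) := strictAnti_nat_of_succ_lt (xPt_succ_lt N)

/-- **Root count for sub-sums**: if `k u < k (u+1)` for `u + 1 < r`, `k u ∈ I`, `k u < 2^n` and `k u ≡ u (mod 2)`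
for `u < r`, then `subV n I` has at least `r - 1` distinct real roots. -/
theorem le_card_roots_subV (n r : ℕ) (I : Finset ℕ) (k : ℕ → ℕ) (hk : ∀ u, u + 1 < r → k u < k (u + 1))
    (hkN : ∀ u, u < r → k u < 2 ^ n) (hkI : ∀ u, u < r → k u ∈ I) (hpar : ∀ u, u < r → k u % 2 = u % 2) :
    r - 1 ≤ ((subV n I).map (Int.castRingHom ℝ)).roots.toFinset.card := by
  rcases Nat.eq_zero_or_pos r with hr | hr
  · subst hr; simp
  · set k' : ℕ → ℕ := fun u => if u < r then k u else 2 ^ n + u with hk'def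
    have hk' : ∀ u, k' u < k' (u + 1) := by
      intro u
      simp only [hk'def]
      split_ifs with h1 h2 h2
      · exact hk u h2
      · exact (hkN u h1).trans_le (Nat.le_add_right _ _)
      · omega
      · omega
    have hk'mono : StrictMono k' := strictMono_nat_of_lt_succ hk'
    have hk'eq : ∀ u, u < r → k' u = k u := fun u hu => by simp only [hk'def, if_pos hu]
    refine le_card_roots_toFinset_of_alternating _ (map_subV_ne_zero n I (hkN 0 hr) (hkI 0 hr))
      (fun u => xPt (2 ^ n) (k' u)) (r - 1) (fun u => xPt_strictAnti _ (hk'mono (Nat.lt_succ_self u))) ?_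
    intro u hu
    have hu' : u < r := by omega
    rw [hk'eq u hu']
    have hs := sign_eval_xPt_subV n (k u) I (hkN u hu') (hkI u hu')
    have hpow : (-1 : ℝ) ^ k u = (-1) ^ u := by
      rw [neg_one_pow_eq_pow_mod_two (R := ℝ), hpar u hu', ← neg_one_pow_eq_pow_mod_two]
    rwa [hpow] at hs

/-! ## Stage 2 — the partial Kronecker substitution on Tavenas' explicit bit polynomial `hV`

`hV k ν = Σ_e xselV e · zselV (vExpBits e)` (tree, `TavenasVnWitness`).  Killing the `x`-variables outside a set `P`
of bit positions (`x_j ↦ [j ∈ P] x^{2^j}`, `z_i ↦ 2^{2^i}`) evaluates `hV` to the sub-sum `subV ν (goodIdx ν P)` over the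
numerals whose binary support lies in `P`. -/


/-- base change of `hV`. -/
theorem map_hV {k k' : Type} [CommRing k] [CommRing k'] (f : k →+* k') (ν : ℕ) :
    MvPolynomial.map f (hV k ν) = hV k' ν := by
  unfold hV xselV zselV
  rw [map_sum]
  refine Finset.sum_congr rfl fun e _ => ?_
  rw [map_mul, map_prod, map_prod]
  congr 1
  · refine Finset.prod_congr rfl fun i _ => ?_
    split_ifs <;> simp
  · refine Finset.prod_congr rfl fun i _ => ?_
    split_ifs <;> simp


/-- Auxiliary step `eval_FP_xselV` of the tower-door witness (verbatim from the workfile). [folklore] -/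
theorem eval_FP_xselV (ν : ℕ) (P : Finset ℕ) (x : ℝ) (e : Fin ν → Bool) :
    MvPolynomial.eval (FP ν P x) (xselV ℝ ν e) =
      if (∀ i : Fin ν, e i = true → (i : ℕ) ∈ P) then x ^ Nat.ofBits e else 0 := by
  unfold xselV
  rw [map_prod]
  have h : ∀ i : Fin ν, MvPolynomial.eval (FP ν P x)
      (if e i then (MvPolynomial.X (Sum.inl (xIdx i)) : MvPolynomial (XZ ν) ℝ) else 1) =
      if e i then (if ((i : ℕ)) ∈ P then x ^ 2 ^ (i : ℕ) else 0) else 1 := by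
    intro i
    cases hi : e i
    · simp
    · simp [FP, xIdx]
  simp only [h]
  split_ifs with hall
  · rw [ofBits_eq_sum, ← Finset.prod_pow_eq_pow_sum]
    refine Finset.prod_congr rfl fun i _ => ?_
    cases hi : e i
    · simp
    · simp [hall i hi]
  · push Not at hall
    obtain ⟨i, hi, hiP⟩ := hall
    exact Finset.prod_eq_zero (Finset.mem_univ i) (by simp [hi, hiP])

/-- Auxiliary step `eval_FP_zselV` of the tower-door witness (verbatim from the workfile). [folklore] -/
theorem eval_FP_zselV (ν : ℕ) (P : Finset ℕ) (x : ℝ) (c : Fin (R ν) → Bool) :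
    MvPolynomial.eval (FP ν P x) (zselV ℝ ν c) = (2 : ℝ) ^ Nat.ofBits c := by
  unfold zselV
  rw [map_prod, ofBits_eq_sum, ← Finset.prod_pow_eq_pow_sum]
  refine Finset.prod_congr rfl fun l _ => ?_
  cases hl : c l
  · simp
  · simp [FP]


/-- Auxiliary step `mem_goodIdx` of the tower-door witness (verbatim from the workfile). [folklore] -/
theorem mem_goodIdx {ν : ℕ} {P : Finset ℕ} {i : ℕ} :
    i ∈ goodIdx ν P ↔ i < 2 ^ ν ∧ ∀ t < ν, Nat.testBit i t = true → t ∈ P := by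
  unfold goodIdx
  rw [mem_filter, mem_range]

/-- Auxiliary step `ofBits_mem_goodIdx` of the tower-door witness (verbatim from the workfile). [folklore] -/
theorem ofBits_mem_goodIdx (ν : ℕ) (P : Finset ℕ) (e : Fin ν → Bool) :
    Nat.ofBits e ∈ goodIdx ν P ↔ ∀ i : Fin ν, e i = true → (i : ℕ) ∈ P := by
  rw [mem_goodIdx]
  constructor
  · rintro ⟨-, h⟩ i hi
    have h' := h i i.2
    rw [Nat.testBit_ofBits, dif_pos i.2] at h'
    exact h' hi
  · intro h
    refine ⟨Nat.ofBits_lt_two_pow e, fun t ht hbit => ?_⟩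
    rw [Nat.testBit_ofBits, dif_pos ht] at hbit
    exact h ⟨t, ht⟩ hbit

/-- **The partial Kronecker identity**: `hV(FP) = subV ν (goodIdx ν P)` evaluated at `x`. -/
theorem eval_FP_hV (ν : ℕ) (P : Finset ℕ) (x : ℝ) :
    MvPolynomial.eval (FP ν P x) (hV ℝ ν) = ((subV ν (goodIdx ν P)).map (Int.castRingHom ℝ)).eval x := by
  unfold hV
  rw [map_sum]
  have h1 : ∀ e : Fin ν → Bool, MvPolynomial.eval (FP ν P x) (xselV ℝ ν e * zselV ℝ ν (vExpBits ν (R ν) e)) =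
      (if Nat.ofBits e ∈ goodIdx ν P then (2 : ℝ) ^ vExp ν (Nat.ofBits e) * x ^ Nat.ofBits e else 0) := by
    intro e
    rw [map_mul, eval_FP_xselV, eval_FP_zselV, vExpBits, ofBits_bitsOf, Nat.mod_eq_of_lt (vExp_lt_two_pow_R ν e)]
    by_cases h : ∀ i : Fin ν, e i = true → (i : ℕ) ∈ P
    · rw [if_pos h, if_pos ((ofBits_mem_goodIdx ν P e).2 h), mul_comm]
    · rw [if_neg h, if_neg (fun h' => h ((ofBits_mem_goodIdx ν P e).1 h')), zero_mul]
  simp only [h1]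
  rw [sum_boolVec_eq_sum_range (fun i => if i ∈ goodIdx ν P then (2 : ℝ) ^ vExp ν i * x ^ i else 0), map_subV,
    eval_finsetSum]
  refine Finset.sum_congr rfl fun i _ => ?_
  split_ifs
  · rw [eval_mul, eval_C, eval_pow, eval_X]
  · rw [eval_zero]


end Summit.ValiantsHypothesis.ValiantsHypothesis.Theorems.LacunarySymmetroid.TowerDoor
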